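import Summits.ValiantsHypothesis.ValiantsHypothesis.Theorems.BarrierLeverChowBenchmarkPairsBlockPeel
import Summits.ValiantsHypothesis.ValiantsHypothesis.Theorems.BarrierLeverChowBenchmarkPairsDirichletSplit

/-!
# Route BarrierLever — item 22038 `ChowBenchmarkPairs`, line `moore-peel`: TYPED NODE «CONJECTURE P′» (every run
# of bad stages is absorbed by the good stage preceding it) and its KERNEL ARROW to node #1 through the block
# peel theorem

Helper file (`--supports stmt-ValiantsHypothesis-22038`; cell valiant-natproofs, rung V4, 𝒟-side benchmark of
record, line `moore_peel`, planner kernel target **K3** (HOME/STATUS.md l.1746: «Conjecture P / B3 as typed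
by-name nodes with their arrow to #1 via K1»); seat val-np-p4 gen 29).  Closes NO item.  One definition
(`Stmt.conjPrefix`, a `Prop`), BY NAME — not a registered stub (R30: block-peel statements are STRONGER devices
than node #1 and enter by name with their arrow).

THE NODE.  Memo `HOME/val-np-p4/g28/memo/MEMO-valnp4-g28.md` §4, CONJECTURE P («preceding-stage absorption»),
in the form the tiling needs (P′: runs need not be maximal on the right): for every good stage `g`
(`det G_g ≠ 0`, i.e. `badStage g = false` by THEOREM W) followed by bad stages `g+1, …, b` (`det G_i = 0`), the
tied block `{g, g+1, …, b}` is nonsingular — `det J^{!}(g, b+1-g)(Λ) ≠ 0` in `ℤ[Λ]` (`blockMatrix` of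
`…BlockPeelRows`; the memo's `J(g-1, b+1-g)`).  EVIDENCE (kit j323569 A, j323570 C, j324541 I1, j324542 I2,
j323832 E; memo §2–§4): the block `{a-1, …, b}` over a maximal bad run `[a, b]` is nonsingular for ALL 110
isolated bad stages below `20 070` and for the five multi-runs where it was computed; every double `{g, g+1}`
with `g` good, `g < 3 000`, is nonsingular (so every length-1 prefix of a run below `3 000` is absorbed); never
observed to fail.  NOT separately computed: proper prefixes of length `≥ 2` of the 3-runs (the certificates of
record use the exact run blocks there).  WHY IT MIGHT FAIL: bad runs grow in length (`≤ 7` below `3·10⁵`), and a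
long run might need MORE than one preceding good stage; the singular doubles `{b, b+1}` at bad `b` show that
torus-equivariant cancellations do occur.  REFUTER TARGET: one good `g` and bad `g+1..b` with
`det J^{!}(g, b+1-g) = 0` at two random points mod two primes (cheapest: the dense cluster `11 586–11 775` and
the long runs `24 060–63`, `96 243–48`).

THE ARROW (kernel, this file): `Stmt.conjPrefix → ∀ h, KernelPoisedAt Nat.factorial h` — the cut points are the
GOOD stages of `[1, h]` (increasing enumeration `Finset.orderEmbOfFin`) and `h+1`: consecutive good stages give a
single (`det J^{!}(g,1) ≠ 0 ↔ det G_g ≠ 0`, `det_blockMatrix_one_X_ne_zero_iff`), a good stage followed by bad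
ones gives a P′-block; stage `1` is good (`det G_1 = 1`); then `kernelPoisedAt_of_blocks` (`…BlockPeel`).  The
conclusion `segmentMeanValue_of_conjPrefix` is the line file's node #1 `∀ h, SegmentMeanValueAt h` VERBATIM.

WHAT THIS IS NOT: `Stmt.conjPrefix` is OPEN (numerically supported, not proved); node #1 is not closed; nothing
on crux stmt-ValiantsHypothesis-14610 or on `VP` versus `VNP`.
-/

set_option linter.dupNamespace false

namespace Summit.ValiantsHypothesis.ValiantsHypothesis.Theorems.BarrierLever.MoorePeel

open Polynomial Finset

/-- **CONJECTURE P′** (memo g28 §4, preceding-stage absorption, typed): for every good stage `g ≥ 1`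
(`det G_g ≠ 0`) and every `b > g` with `det G_i = 0` for all `g < i ≤ b`, the tied block `{g, …, b}` of the
segment-weighted hierarchical Moore peel has nonzero symbolic block determinant `det J^{!}(g, b+1-g)(Λ) ≠ 0`. -/
def Stmt.conjPrefix : Prop :=
  ∀ g b : ℕ, 1 ≤ g → g < b → (peelMatrix g).det ≠ 0 → (∀ i, g < i → i ≤ b → (peelMatrix i).det = 0) →
    (blockMatrix Nat.factorial g (b + 1 - g)
      (fun s : Fin (b + 1 - g) => (MvPolynomial.X s : MvPolynomial (Fin (b + 1 - g)) ℤ))).det ≠ 0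

/-- Transport of a block hypothesis along an equality of block lengths. -/
theorem det_blockMatrix_X_ne_zero_of_eq' (κ : ℕ → ℕ) (i : ℕ) {t t' : ℕ} (e : t = t')
    (h : (blockMatrix κ i t' (fun s : Fin t' => (MvPolynomial.X s : MvPolynomial (Fin t') ℤ))).det ≠ 0) :
    (blockMatrix κ i t (fun s : Fin t => (MvPolynomial.X s : MvPolynomial (Fin t) ℤ))).det ≠ 0 := by
  subst e
  exact h

/-- A single at a good stage: `det G_g ≠ 0 ⇒ det J^{!}(g, 1)(Λ) ≠ 0`. -/
theorem det_blockMatrix_factorial_one_ne_zero (g : ℕ) (hg : (peelMatrix g).det ≠ 0) :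
    (blockMatrix Nat.factorial g 1 (fun s : Fin 1 => (MvPolynomial.X s : MvPolynomial (Fin 1) ℤ))).det ≠ 0 := by
  rw [det_blockMatrix_one_X_ne_zero_iff, kpeelMatrix_factorial]
  exact hg

/-- **THE ARROW `P′ ⇒ node #1`** (kernel poisedness form): under CONJECTURE P′, `KernelPoisedAt k! h` for EVERY
`h` — cut `[1, h+1]` at the good stages and at `h+1` and apply the block peel theorem. -/
theorem kernelPoisedAt_factorial_of_conjPrefix (hP : Stmt.conjPrefix) (h : ℕ) : KernelPoisedAt Nat.factorial h := by
  classical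
  -- the cut points: good stages of `[1, h]`, and `h + 1`
  set S : Finset ℕ := (Finset.range (h + 2)).filter
    (fun c => (1 ≤ c ∧ c ≤ h ∧ (peelMatrix c).det ≠ 0) ∨ c = h + 1) with hS
  have hmemS : ∀ c, c ∈ S ↔ (1 ≤ c ∧ c ≤ h ∧ (peelMatrix c).det ≠ 0) ∨ c = h + 1 := by
    intro c
    rw [hS, Finset.mem_filter, Finset.mem_range]
    constructor
    · exact fun hc => hc.2
    · intro hc
      refine ⟨?_, hc⟩
      rcases hc with hc | hc <;> omega
  have htop : h + 1 ∈ S := (hmemS _).mpr (Or.inr rfl)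
  have hone : 1 ∈ S := by
    rcases Nat.eq_zero_or_pos h with hz | hpos
    · exact (hmemS _).mpr (Or.inr (by omega))
    · exact (hmemS _).mpr (Or.inl ⟨le_rfl, hpos, det_peelMatrix_ne_zero_of_le_182_by_W 1 (by norm_num) le_rfl⟩)
  have hge1 : ∀ c ∈ S, 1 ≤ c := fun c hc => by
    rcases (hmemS c).mp hc with hc | hc <;> omega
  have hle : ∀ c ∈ S, c ≤ h + 1 := fun c hc => by
    rcases (hmemS c).mp hc with hc | hc <;> omega
  set k := S.card with hk
  have hkpos : 0 < k := Finset.card_pos.mpr ⟨1, hone⟩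
  set emb := S.orderEmbOfFin hk.symm with hemb
  set a : ℕ → ℕ := fun q => if hq : q < k then emb ⟨q, hq⟩ else h + 1 with ha
  have ha_of_lt : ∀ q (hq : q < k), a q = emb ⟨q, hq⟩ := fun q hq => by simp only [ha, dif_pos hq]
  have hsurj : ∀ x ∈ S, ∃ j : Fin k, emb j = x := by
    intro x hx
    have : x ∈ Set.range emb := by rw [hemb, Finset.range_orderEmbOfFin]; exact hx
    exact this
  have hmono : ∀ q, q + 1 < k → a q < a (q + 1) := by
    intro q hq
    rw [ha_of_lt q (by omega), ha_of_lt (q + 1) hq]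
    exact emb.strictMono (Fin.mk_lt_mk.mpr (Nat.lt_succ_self q))
  have hmem_a : ∀ q (hq : q < k), a q ∈ S := fun q hq => by
    rw [ha_of_lt q hq]
    exact Finset.orderEmbOfFin_mem S hk.symm _
  -- no cut point strictly between two consecutive cut points
  have hgap : ∀ q (hq : q + 1 < k) (x : ℕ), a q < x → x < a (q + 1) → x ∉ S := by
    intro q hq x h1 h2 hx
    obtain ⟨j, hj⟩ := hsurj x hx
    rw [ha_of_lt q (by omega)] at h1
    rw [ha_of_lt (q + 1) hq] at h2
    rw [← hj] at h1 h2
    have h1' := emb.lt_iff_lt.mp h1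
    have h2' := emb.lt_iff_lt.mp h2
    rw [Fin.lt_def] at h1' h2'
    simp only at h1' h2'
    omega
  refine kernelPoisedAt_of_blocks Nat.factorial (fun k => Nat.factorial_ne_zero k) h (k - 1) a ?_ ?_ ?_ ?_
  · -- `a 0 = min S = 1`
    rw [ha_of_lt 0 hkpos]
    show emb ⟨0, hkpos⟩ = 1
    rw [hemb, Finset.orderEmbOfFin_zero hk.symm hkpos]
    exact le_antisymm (Finset.min'_le S 1 hone) (Finset.le_min' _ _ _ fun c hc => hge1 c hc)
  · -- `a (k-1) = max S = h + 1`
    rw [ha_of_lt (k - 1) (by omega)]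
    have e : (⟨k - 1, by omega⟩ : Fin k) = ⟨k - 1, Nat.sub_lt hkpos (Nat.succ_pos 0)⟩ := rfl
    rw [e, hemb, Finset.orderEmbOfFin_last hk.symm hkpos]
    exact le_antisymm (Finset.max'_le _ _ _ fun c hc => hle c hc) (Finset.le_max' S (h + 1) htop)
  · -- strictly increasing
    intro q hq
    exact hmono q (by omega)
  · -- every block is a single at a good stage or a P′-block
    intro q hq
    have hq1 : q + 1 < k := by omega
    have hlt := hmono q hq1
    have hcS := hmem_a q (by omega)
    have hc'le : a (q + 1) ≤ h + 1 := hle _ (hmem_a (q + 1) hq1)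
    have hgood : 1 ≤ a q ∧ a q ≤ h ∧ (peelMatrix (a q)).det ≠ 0 := by
      rcases (hmemS _).mp hcS with hc | hc
      · exact hc
      · exfalso; omega
    by_cases hsingle : a (q + 1) = a q + 1
    · rw [hsingle, Nat.add_sub_cancel_left]
      exact det_blockMatrix_factorial_one_ne_zero (a q) hgood.2.2
    · have hb : a q < a (q + 1) - 1 := by omega
      have hbad : ∀ i, a q < i → i ≤ a (q + 1) - 1 → (peelMatrix i).det = 0 := by
        intro i h1 h2
        by_contra hne
        exact hgap q hq1 i h1 (by omega) ((hmemS i).mpr (Or.inl ⟨by omega, by omega, hne⟩))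
      have e : a (q + 1) - a q = a (q + 1) - 1 + 1 - a q := by omega
      exact det_blockMatrix_X_ne_zero_of_eq' Nat.factorial (a q) e
        (hP (a q) (a (q + 1) - 1) hgood.1 hb hgood.2.2 hbad)

/-- **THE ARROW `P′ ⇒ node #1`**, verbatim: under CONJECTURE P′ the line file's `SegmentMeanValueAt h` holds for
EVERY `h`, i.e. the registered node #1 `stub_segmentMeanValue` (`∀ h, SegmentMeanValueAt h`) follows. -/
theorem segmentMeanValue_of_conjPrefix (hP : Stmt.conjPrefix) (h : ℕ) :
    ∀ (r : ℕ) (u : Fin r → Finset (Fin h)), Function.Injective u → (∀ i, (u i).card ≤ 2) →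
      (∀ S : Finset (Fin h), S.card ≤ 2 → ∃ i, u i = S) →
      ∃ P : Fin h → Fin h → ℂ,
        (Matrix.of fun i j : Fin r =>
          ∑ g : (↥(benchCols h r j) → ↥(u i)), (∏ c : ↥(benchCols h r j), P (g c) c) *
            ∏ a : ↥(u i),
              ((Finset.univ.filter fun c : ↥(benchCols h r j) => g c = a).card.factorial : ℂ)).det ≠ 0 :=
  kernelPoisedAt_factorial_of_conjPrefix hP h

end Summit.ValiantsHypothesis.ValiantsHypothesis.Theorems.BarrierLever.MoorePeel
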